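import Mathlib
import HarnessLib
import Literature.AlgebraicGeometry.HodgeTheory.NormalFunctionSingularity
import Literature.AlgebraicGeometry.HodgeTheory.BiextensionHeightPackage
import Summits.HodgeConjecture.HodgeConjecture.Theses.LinearSystemTorelli

/-!
# Sketch — crux-ideate r2 k4 on stmt-HodgeConjecture-1081 (`LinearSystemTorelli.MiddleDivisorSupport`)

Idea `invisible-class-height-rigidity`: a class that would violate the crux for `X` can be taken
INVISIBLE (`ζ|_{X_s} = 0` on every singular member of every `|kH|`; Hodge–Riemann + Deligne 8.2.8,
evidence `DetectionForm.lean` on the item), and an invisible class has, at EVERY level `k`, a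
Brosnan–Pearlstein biextension height whose canonically normalised potential is GLOBALLY BOUNDED on
`|kH| ∖ X̂_k` — hence full non-pluripolar Monge–Ampère mass `M_j(k) = δ_k^j` for all `j`
(Bedford–Taylor).  Contrapositive: route `HeightMassDefect`'s target `MassDefect` (stmt-2819:
`∃ k j, M_j(k) < δ_k^j`) implies detection of `ζ` by a singular member at the SAME level `k`, with no
appeal to `sing_p`, to Kerr–Pearlstein (3-7) or to `k ≫ 0`; i.e. `MassDefect → MiddleDivisorSupport`.

This file types the two ends of that bridge over EXISTING declarations
(`NormalFunctionSingularity`, `BiextensionHeightPackage`) and kernel-checks the logic of the chain;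
the analytic middle (`NonsingularBounded`, = BP Thm 13/14/16/17 + case (b) p. 6 in the `ℒ̄_can`
normalisation, after the local-system splitting argument of the card) is a named `Prop` over an
abstract tie `Tie` between a height package and `(X, e, k, ζ)` (the package is a hypothesis
structure with junk inhabitants, so the tie cannot be a definition today — definition request D1 of
the card).  No `sorry`, no axioms.
-/

noncomputable section

open Filter Topology
open scoped LinearAlgebra.Projectivization
open Literature.AlgebraicGeometry Literature.AlgebraicGeometry.HodgeTheory
open Literature.AlgebraicGeometry.Resolution (Monomials formOfCoeffs isHomogeneous_formOfCoeffs)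

namespace Summit.HodgeConjecture.HodgeConjecture.Cruxes.MiddleDivisorSupport.InvisibleRigidity

variable {X : Motives.SchemeOver ℂ} (e : Motives.ProjectiveEmbedding X)

/-! ### The topological end: invisible classes have non-singular normal functions -/

/-- `ζ` is **invisible at level `k`**: it restricts to zero on EVERY singular member `X_{F_a}` of
`|kH|` (`a` in the cone over the dual variety).  Together with primitivity (`IsPrimitiveFor`: zero on
the smooth members) this says `ζ ⟂ N_{X_s}` for all `s ∈ |kH|`; a counterexample to
`MiddleDivisorSupport` on `X` yields, by Hodge–Riemann, a non-zero class invisible at every level. -/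
def InvisibleAt (k : ℕ) {d : ℕ} (ζ : complexBetti X d) : Prop :=
  ∀ a ∈ dualVarietyCone e k, restrictToMember e (formOfCoeffs a) d ζ = 0

/-- **Detection at level `k`** (the shape of `HeightMassDefect.SectionRestriction` for ONE class and
ONE degree): some singular member of `|kH|` sees `ζ`. -/
def DetectedAt (k : ℕ) {d : ℕ} (ζ : complexBetti X d) : Prop :=
  ∃ a ∈ dualVarietyCone e k, restrictToMember e (formOfCoeffs a) d ζ ≠ 0

variable {e} in
theorem detectedAt_iff_not_invisibleAt (k : ℕ) {d : ℕ} (ζ : complexBetti X d) :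
    DetectedAt e k ζ ↔ ¬ InvisibleAt e k ζ := by
  simp only [DetectedAt, InvisibleAt, not_forall, exists_prop]

/-- **Retraction vanishing** (topological fact, dCM (13) / BFNP Para 37: for a small ball `B`
around `a`, the incidence variety `𝒳_B` deformation-retracts onto the member `X_{F_a}`, compatibly
with `pr₁^*`): if `ζ|_{X_{F_a}} = 0` then `pr₁^* ζ = 0` on `𝒳_B` for some neighbourhood `B` of `a`.
Named here as a `Prop` (to become a fact of the requested companion file
`NormalFunctionSingularityFacts`). [cite: DecataldoMigliorini2009, §2.1 (13)]
[cite: BrosnanFangNiePearlstein2009, Para 37] -/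
def RetractionVanishing : Prop :=
  ∀ ⦃X : Motives.SchemeOver ℂ⦄ (e : Motives.ProjectiveEmbedding X) (k d : ℕ) (ζ : complexBetti X d)
    (a : CoeffSpace e.n k), a ∈ dualVarietyCone e k →
    restrictToMember e (formOfCoeffs a) d ζ = 0 → ∃ B ∈ 𝓝 a, familyClassMap e k B d ζ = 0

variable {e} in
/-- **Invisible ⟹ the normal function is singular nowhere** (all `k`, no `k ≫ 0`): granted
retraction vanishing, `pr₁^*ζ` dies over a whole ball around each point of the dual-variety cone,
a fortiori over its smooth members, which is the negation of the tree's (dCM/BFNP-faithful) rendering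
of `sing_a(ν_{ζ,k}) ≠ 0`. -/
theorem not_isSingularOn_of_invisibleAt (hR : RetractionVanishing) {k d : ℕ} {ζ : complexBetti X d}
    (hInv : InvisibleAt e k ζ) : ¬ IsSingularOn e k ζ := by
  rintro ⟨a, ha, hsing⟩
  obtain ⟨B, hB, h0⟩ := hR e k d ζ a ha (hInv a ha)
  have h0' : familyClassMap e k (B ∩ smoothLocus e k) d ζ = 0 :=
    familyClassMap_eq_zero_of_subset e k Set.inter_subset_left h0
  exact not_admissibleNormalFunctionSingularity_of_eq_zero hB h0' hsing

/-! ### The pluripotential end: bounded normalised potential ⟹ full Monge–Ampère mass -/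

variable {N : ℕ} {D : Set (ℙ ℂ (Fin (N + 1) → ℂ))}

/-- The canonically normalised potential `pot − d·log‖·‖` of the height package is **bounded** on the
cone over `ℙᴺ ∖ D` (it is automatically bounded near SMOOTH boundary points in the `ℒ̄_can`
normalisation, field `exists_tendsto_pot_of_transversal`; the content is boundedness near the deep
strata of `D`). -/
def HasBoundedNormalisedPotential (P : BiextensionHeightPackage N D) : Prop :=
  ∃ C : ℝ, ∀ v : Fin (N + 1) → ℂ, v ≠ 0 → v ∉ Projectivization.conePreimage D →
    |P.pot v - P.extDegree * Real.log ‖v‖| ≤ C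

/-- **Full mass**: no non-pluripolar Monge–Ampère mass is lost into `D`, `M_j = δ^j` for
`1 ≤ j ≤ N` (the negation of `HeightMassDefect.MassDefect` at this level). -/
def HasFullMass (P : BiextensionHeightPackage N D) : Prop :=
  ∀ j : ℕ, 1 ≤ j → j ≤ N → P.mass j = P.degree ^ j

/-- **Bedford–Taylor / BEGZ** (theorem in print, stated as a `Prop` over the package): a closed
positive `(1,1)`-current on `ℙᴺ` with a BOUNDED global potential charges no pluripolar set and its
Bedford–Taylor powers have the cohomological masses; for the height package (smooth on the cone over
`S`, psh, log-homogeneous of degree `d`) this reads `M_j = δ^j` for all `j`.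
[cite: BoucksomEtAl2010, Thm. 1.16 and Prop. 1.20] (Bedford–Taylor, Acta Math. 149 (1982)). -/
def BoundedPotentialFullMass : Prop :=
  ∀ (N : ℕ) (D : Set (ℙ ℂ (Fin (N + 1) → ℂ))) (P : BiextensionHeightPackage N D),
    HasBoundedNormalisedPotential P → HasFullMass P

/-! ### The analytic middle, over an abstract tie (definition request D1 of the card) -/

/-- A **tie** says: "`P` is THE height package of the biextension variation of
`(ν_{ζ,k}, ν_{ζ,k}^∨)` on `|kH| ∖ X̂_k`" (Hain–Reed bundle, BP metric, `ℒ̄_can` normalisation).  Not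
definable today (no VMHS / normal functions in tree); abstracted as a predicate. -/
abbrev Tie : Type 1 :=
  ∀ ⦃X : Motives.SchemeOver ℂ⦄ (e : Motives.ProjectiveEmbedding X) (k d : ℕ) (_ζ : complexBetti X d)
    (N : ℕ) (D : Set (ℙ ℂ (Fin (N + 1) → ℂ))), BiextensionHeightPackage N D → Prop

/-- **THE LEVER** (card `invisible-class-height-rigidity`, analytic half): if `ν_{ζ,k}` is singular
NOWHERE on the dual variety then the normalised biextension potential is GLOBALLY BOUNDED.  Proof in
the card: at each `p ∈ X̂_k` the local `ℚ`-local system of the biextension splits as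
`ℋ ⊕ E(χ)` (both extension classes are the local Leray class of `ζ`, zero by non-singularity in the
dCM rendering), the Kummer character `χ` is determined by meridians of the local branches of `X̂_k`,
on which it equals the codimension-one Lear rate `= 0` (`ℒ̄_can`), so on a log resolution all rates
`μ_j` vanish and BP's case (b) (`sing = 0 ⟹ h̄ = h` bounded; Thms 13, 14, 16, 17) applies at every
point. [cite: BrosnanPearlstein2019, Thm. 13, Thm. 14, Thm. 16, Thm. 17, Cor. 7 and §1.2 (a)/(b)] -/
def NonsingularBounded (T : Tie) : Prop :=
  ∀ ⦃X : Motives.SchemeOver ℂ⦄ (e : Motives.ProjectiveEmbedding X) (k d : ℕ) (ζ : complexBetti X d)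
    (N : ℕ) (D : Set (ℙ ℂ (Fin (N + 1) → ℂ))) (P : BiextensionHeightPackage N D),
    T e k d ζ N D P → ¬ IsSingularOn e k ζ → HasBoundedNormalisedPotential P

/-- `MassDefect` for ONE class at ONE level, over the tie (the shape of route `HeightMassDefect`'s
informal target stmt-HodgeConjecture-2819, which quantifies `∃ k` over this). -/
def MassDefectAt (T : Tie) (k : ℕ) {d : ℕ} (ζ : complexBetti X d) : Prop :=
  ∃ (N : ℕ) (D : Set (ℙ ℂ (Fin (N + 1) → ℂ))) (P : BiextensionHeightPackage N D),
    T e k d ζ N D P ∧ ¬ HasFullMass P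

variable {e} in
/-- **THE BRIDGE, kernel-checked logic**: retraction vanishing + the lever + Bedford–Taylor turn a
mass defect at level `k` into DETECTION of `ζ` by a singular member of the same `|kH|`. -/
theorem detectedAt_of_massDefectAt (T : Tie) (hR : RetractionVanishing) (hNB : NonsingularBounded T)
    (hBT : BoundedPotentialFullMass) {k d : ℕ} {ζ : complexBetti X d}
    (hMD : MassDefectAt e T k ζ) : DetectedAt e k ζ := by
  rw [detectedAt_iff_not_invisibleAt]
  intro hInv
  obtain ⟨N, D, P, hT, hnot⟩ := hMD
  exact hnot (hBT N D P (hNB e k d ζ N D P hT (not_isSingularOn_of_invisibleAt hR hInv)))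

/-- A priori form of a counterexample (INVERSION): if `ζ` is invisible at level `k` then every tied
height package at level `k` has bounded normalised potential and full mass. -/
theorem fullMass_of_invisibleAt (T : Tie) (hR : RetractionVanishing) (hNB : NonsingularBounded T)
    (hBT : BoundedPotentialFullMass) {k d : ℕ} {ζ : complexBetti X d} (hInv : InvisibleAt e k ζ)
    {N : ℕ} {D : Set (ℙ ℂ (Fin (N + 1) → ℂ))} (P : BiextensionHeightPackage N D)
    (hT : T e k d ζ N D P) : HasBoundedNormalisedPotential P ∧ HasFullMass P :=
  have hb := hNB e k d ζ N D P hT (not_isSingularOn_of_invisibleAt hR hInv)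
  ⟨hb, hBT N D P hb⟩

/-! ### Attach point: the crux, by name -/

/-- The crux served (route decl, by name). -/
abbrev Crux : Prop := Summit.HodgeConjecture.HodgeConjecture.Theses.LinearSystemTorelli.MiddleDivisorSupport

/-- **Global detection** (`HeightMassDefect.SectionRestriction` restricted to the cone rendering):
every non-zero primitive rational middle Hodge class of an even-dimensional `X` is detected by a
singular member of some `|kH|`.  Per `X` this is equivalent to `MiddleDivisorSupport` for `X`
(Hodge–Riemann non-degeneracy on Hodge classes + Deligne 8.2.8: evidence `DetectionForm.lean` on
stmt-1081; KP Thm 42 'if'); the card's transfer is `(∀ X ζ, ∃ k, MassDefectAt) → GlobalDetection`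
by `detectedAt_of_massDefectAt`. -/
def GlobalDetection : Prop :=
  ∀ ⦃p : ℕ⦄ ⦃X : Motives.SchemeOver ℂ⦄, 1 ≤ p → Motives.IsSmoothProjective (2 * p) X →
    ∀ (e : Motives.ProjectiveEmbedding X) (ζ : complexBetti X (2 * p)), IsRationalClass ζ →
    IsOfHodgeType (2 * p) X (2 * p) p p ζ → ζ ≠ 0 → (∀ k, 1 ≤ k → IsPrimitiveFor e k ζ) →
    ∃ k, 1 ≤ k ∧ DetectedAt e k ζ

/-- Transfer, kernel-checked: a mass defect for every non-zero primitive middle Hodge class gives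
global detection. -/
theorem globalDetection_of_massDefect (T : Tie) (hR : RetractionVanishing) (hNB : NonsingularBounded T)
    (hBT : BoundedPotentialFullMass)
    (hMD : ∀ ⦃p : ℕ⦄ ⦃X : Motives.SchemeOver ℂ⦄, 1 ≤ p → Motives.IsSmoothProjective (2 * p) X →
      ∀ (e : Motives.ProjectiveEmbedding X) (ζ : complexBetti X (2 * p)), IsRationalClass ζ →
      IsOfHodgeType (2 * p) X (2 * p) p p ζ → ζ ≠ 0 → (∀ k, 1 ≤ k → IsPrimitiveFor e k ζ) →
      ∃ k, 1 ≤ k ∧ MassDefectAt e T k ζ) :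
    GlobalDetection := by
  intro p X hp hX e ζ hrat hh hne hprim
  obtain ⟨k, hk, hmd⟩ := hMD hp hX e ζ hrat hh hne hprim
  exact ⟨k, hk, detectedAt_of_massDefectAt T hR hNB hBT hmd⟩

end Summit.HodgeConjecture.HodgeConjecture.Cruxes.MiddleDivisorSupport.InvisibleRigidity

end
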